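import Summits.Ventures.HodgeRepro2.T5CartanSU11

/-!
# T5CayleySU11 — the Cayley transform `SL(2,ℝ) ≅ SU(1,1)`, kernel-checked

Support for `route/T5-N4-p5.md` (sub-step N4.3 = (R3)), step (N4.3.P2′), which passes between
`H_j¹ := SU(1,1)` (Rühl's group, coordinates `u(ψ₁) d(η) u(ψ₂)`) and `SL(2,ℝ)` (Bargmann's list as
printed in Gelbart) through the isomorphism «`SU(1,1) ≅ SL(2,ℝ)`», and identifies
`K_W ∩ SU(1,1) = SO(2)`.  The isomorphism is conjugation by the Cayley matrix
`C = !![1, -I; 1, I]` (`C⁻¹ = ½ · !![1, 1; I, -I]`):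

* `cayleyConj_real`: for real `p q r s`,
  `C · !![p, q; r, s] · C⁻¹ = !![a, b; conj b, conj a]` with `a = ((p + s) + (q − r) I)/2`,
  `b = ((p − s) − (q + r) I)/2`, and `‖a‖² − ‖b‖² = ps − qr` (`normSq_cayleyA_sub_normSq_cayleyB`);
* `memU11_cayleyConj_real` / `det_cayleyConj`: `SL(2,ℝ)` lands in `SU(1,1)` (`MemU11`, `det = 1`);
* `exists_real_of_memU11_det_one`: every element of `SU(1,1)` is `C h C⁻¹` for a real `h` of
  determinant one — with `cayleyConj_mul`, `cayleyConj_one`, `cayleyConj_injective` this is the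
  group isomorphism `SL(2,ℝ) ≅ SU(1,1)` of (N4.3.P2′);
* `cayleyConj_rotation`: `SO(2) ∋ !![cos θ, -sin θ; sin θ, cos θ] ↦ !![exp(-θ I), 0; 0, exp(θ I)]`
  — the diagonal torus `K_W ∩ SU(1,1)`; hence the `K_W`-character `(m, n)` restricts to the
  `SO(2)`-weight `m − n` on `rotation (-θ)` (`torus_character_rotation_neg`), and the `K_W`-type
  `((m′+3)/2 + k, (m′−3)/2 − k)` of (N4.3.P2-bis) restricts to the weight `3 + 2k` of (N4.3.P2′)
  (`ktype_weight`);
* `cayleyConj_cartanReal`: the split Cartan `!![exp t, 0; 0, exp (-t)]` of `SL(2,ℝ)` maps to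
  `hyperbolicC t = !![cosh t, sinh t; sinh t, cosh t]`, the `A⁺` of `T5CartanU11` / `T5CartanSU11`;
* `exists_cartan_real`: `SL(2,ℝ) = SO(2) · A⁺ · SO(2)`, transported from
  `T5CartanSU11.exists_cartan_det_one` through the Cayley transform.

Honest scope: matrices only — nothing about representations, Bargmann's classification, Rühl's
measure or the Weil representation is formalised.  Orientation: with `rotation θ` as above the
`(0,0)` entry of its image is `exp(-θ I)`; the opposite orientation of `SO(2)` (`θ ↦ -θ`) gives
`exp(θ I)` there — both signs are recorded.
-/

noncomputable section

namespace Summit.Ventures.HodgeRepro2.T5CayleySU11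

open Complex Matrix
open scoped ComplexConjugate

/-- The Cayley matrix `C = !![1, -I; 1, I]`. -/
def cayley : Matrix (Fin 2) (Fin 2) ℂ := !![1, -I; 1, I]

/-- Its inverse `C⁻¹ = ½ · !![1, 1; I, -I]`. -/
def cayleyInv : Matrix (Fin 2) (Fin 2) ℂ := !![1 / 2, 1 / 2; I / 2, -I / 2]

/-- Conjugation by the Cayley matrix, `h ↦ C h C⁻¹`. -/
def cayleyConj (h : Matrix (Fin 2) (Fin 2) ℂ) : Matrix (Fin 2) (Fin 2) ℂ :=
  cayley * h * cayleyInv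

/-- The `(0,0)` entry of `C · !![p, q; r, s] · C⁻¹`: `a = ((p + s) + (q − r) I)/2`. -/
def cayleyA (p q r s : ℝ) : ℂ := (((p + s) / 2 : ℝ) : ℂ) + (((q - r) / 2 : ℝ) : ℂ) * I

/-- The `(0,1)` entry of `C · !![p, q; r, s] · C⁻¹`: `b = ((p − s) − (q + r) I)/2`. -/
def cayleyB (p q r s : ℝ) : ℂ := (((p - s) / 2 : ℝ) : ℂ) - (((q + r) / 2 : ℝ) : ℂ) * I

/-- The rotation `!![cos θ, -sin θ; sin θ, cos θ] ∈ SO(2) ⊂ SL(2,ℝ)`, read in `M₂(ℂ)`. -/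
def rotation (θ : ℝ) : Matrix (Fin 2) (Fin 2) ℂ :=
  !![(Real.cos θ : ℂ), -(Real.sin θ : ℂ); (Real.sin θ : ℂ), (Real.cos θ : ℂ)]

/-- The split Cartan element `!![exp t, 0; 0, exp (-t)]` of `SL(2,ℝ)`, read in `M₂(ℂ)`. -/
def cartanReal (t : ℝ) : Matrix (Fin 2) (Fin 2) ℂ :=
  !![(Real.exp t : ℂ), 0; 0, (Real.exp (-t) : ℂ)]

/-- `C C⁻¹ = 1`. -/
theorem cayley_mul_cayleyInv : cayley * cayleyInv = 1 := by
  ext i j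
  fin_cases i <;> fin_cases j <;>
    simp [cayley, cayleyInv, Matrix.mul_apply, Fin.sum_univ_two, Complex.ext_iff,
      Complex.div_ofNat_re, Complex.div_ofNat_im] <;> norm_num

/-- `C⁻¹ C = 1`. -/
theorem cayleyInv_mul_cayley : cayleyInv * cayley = 1 := by
  ext i j
  fin_cases i <;> fin_cases j <;>
    simp [cayley, cayleyInv, Matrix.mul_apply, Fin.sum_univ_two, Complex.ext_iff,
      Complex.div_ofNat_re, Complex.div_ofNat_im] <;> norm_num

/-- Conjugation by `C` is multiplicative. -/
theorem cayleyConj_mul (h h' : Matrix (Fin 2) (Fin 2) ℂ) :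
    cayleyConj (h * h') = cayleyConj h * cayleyConj h' := by
  unfold cayleyConj
  calc cayley * (h * h') * cayleyInv
      = cayley * h * (cayleyInv * cayley) * h' * cayleyInv := by
        rw [cayleyInv_mul_cayley]; simp [Matrix.mul_assoc]
    _ = cayley * h * cayleyInv * (cayley * h' * cayleyInv) := by simp [Matrix.mul_assoc]

/-- Conjugation by `C` fixes the identity. -/
theorem cayleyConj_one : cayleyConj 1 = 1 := by
  unfold cayleyConj; rw [Matrix.mul_one, cayley_mul_cayleyInv]

/-- Conjugation by `C` is injective (its inverse is conjugation by `C⁻¹`). -/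
theorem cayleyConj_injective : Function.Injective cayleyConj := by
  intro h h' hh
  have key : ∀ g : Matrix (Fin 2) (Fin 2) ℂ, cayleyInv * cayleyConj g * cayley = g := by
    intro g
    unfold cayleyConj
    calc cayleyInv * (cayley * g * cayleyInv) * cayley
        = (cayleyInv * cayley) * g * (cayleyInv * cayley) := by simp [Matrix.mul_assoc]
      _ = g := by rw [cayleyInv_mul_cayley, Matrix.one_mul, Matrix.mul_one]
  rw [← key h, ← key h', hh]

/-- Conjugation by `C` preserves the determinant. -/
theorem det_cayleyConj (h : Matrix (Fin 2) (Fin 2) ℂ) : (cayleyConj h).det = h.det := by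
  unfold cayleyConj
  rw [Matrix.det_mul, Matrix.det_mul, mul_comm, ← mul_assoc, ← Matrix.det_mul,
    cayleyInv_mul_cayley, Matrix.det_one, one_mul]

/-- `‖a‖² − ‖b‖² = ps − qr` for the Cayley entries `a = cayleyA p q r s`, `b = cayleyB p q r s`. -/
theorem normSq_cayleyA_sub_normSq_cayleyB (p q r s : ℝ) :
    normSq (cayleyA p q r s) - normSq (cayleyB p q r s) = p * s - q * r := by
  simp only [cayleyA, cayleyB, normSq_apply]
  simp [Complex.add_re, Complex.add_im, Complex.sub_re, Complex.sub_im, Complex.mul_re,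
    Complex.mul_im, Complex.div_ofNat_re, Complex.div_ofNat_im]
  ring

/-- THE CAYLEY TRANSFORM OF A REAL MATRIX:
`C · !![p, q; r, s] · C⁻¹ = !![a, b; conj b, conj a]` with `a = ((p + s) + (q − r) I)/2` and
`b = ((p − s) − (q + r) I)/2`. -/
theorem cayleyConj_real (p q r s : ℝ) :
    cayleyConj !![(p : ℂ), (q : ℂ); (r : ℂ), (s : ℂ)] =
      !![cayleyA p q r s, cayleyB p q r s; conj (cayleyB p q r s), conj (cayleyA p q r s)] := by
  unfold cayleyConj cayleyA cayleyB
  ext i j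
  fin_cases i <;> fin_cases j <;>
    simp [cayley, cayleyInv, Matrix.mul_apply, Fin.sum_univ_two, Complex.ext_iff, map_ofNat,
      Complex.div_ofNat_re, Complex.div_ofNat_im] <;>
    refine ⟨?_, ?_⟩ <;> ring

/-- A matrix of the form `!![a, b; conj b, conj a]` with `‖a‖² − ‖b‖² = 1` lies in `U(1,1)`. -/
theorem memU11_of_form (a b : ℂ) (h : normSq a - normSq b = 1) :
    T5UnitaryBound.MemU11 !![a, b; conj b, conj a] := by
  unfold T5UnitaryBound.MemU11 T5UnitaryBound.J
  have ha : conj a * a = (normSq a : ℂ) := by rw [mul_comm]; exact Complex.mul_conj a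
  have hb : conj b * b = (normSq b : ℂ) := by rw [mul_comm]; exact Complex.mul_conj b
  have h' : (normSq a : ℂ) - (normSq b : ℂ) = 1 := by exact_mod_cast h
  ext i j
  fin_cases i <;> fin_cases j <;>
    simp [Matrix.mul_apply, Fin.sum_univ_two, Matrix.conjTranspose_apply] <;>
    first
    | linear_combination ha - hb + h'
    | linear_combination hb - ha - h'
    | ring1

/-- The determinant of `!![a, b; conj b, conj a]` is `‖a‖² − ‖b‖²`. -/
theorem det_of_form (a b : ℂ) :
    (!![a, b; conj b, conj a]).det = ((normSq a - normSq b : ℝ) : ℂ) := by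
  rw [Matrix.det_fin_two_of, Complex.mul_conj, Complex.mul_conj]
  push_cast; ring

/-- `SL(2,ℝ)` lands in `SU(1,1)`: `MemU11 (C h C⁻¹)` for real `h` with `ps − qr = 1`. -/
theorem memU11_cayleyConj_real {p q r s : ℝ} (h : p * s - q * r = 1) :
    T5UnitaryBound.MemU11 (cayleyConj !![(p : ℂ), (q : ℂ); (r : ℂ), (s : ℂ)]) := by
  rw [cayleyConj_real]
  exact memU11_of_form _ _ (by rw [normSq_cayleyA_sub_normSq_cayleyB]; exact h)

/-- `det (C h C⁻¹) = ps − qr` for real `h = !![p, q; r, s]`. -/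
theorem det_cayleyConj_real (p q r s : ℝ) :
    (cayleyConj !![(p : ℂ), (q : ℂ); (r : ℂ), (s : ℂ)]).det = ((p * s - q * r : ℝ) : ℂ) := by
  rw [det_cayleyConj, Matrix.det_fin_two_of]; push_cast; ring

/-- EVERY ELEMENT OF `SU(1,1)` IS THE CAYLEY TRANSFORM OF A REAL MATRIX OF DETERMINANT ONE:
with `a = g 0 0`, `b = g 0 1`, take `p = Re a + Re b`, `q = Im a − Im b`, `r = −Im a − Im b`,
`s = Re a − Re b`. -/
theorem exists_real_of_memU11_det_one {g : Matrix (Fin 2) (Fin 2) ℂ}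
    (hg : T5UnitaryBound.MemU11 g) (hd : g.det = 1) :
    ∃ p q r s : ℝ, p * s - q * r = 1 ∧ g = cayleyConj !![(p : ℂ), (q : ℂ); (r : ℂ), (s : ℂ)] := by
  have h11 := T5CartanSU11.entry_11_eq_conj_00 hg hd
  have h10 := T5CartanSU11.entry_10_eq_conj_01 hg hd
  set a := g 0 0 with ha
  set b := g 0 1 with hb
  have hform : g = !![a, b; conj b, conj a] := by
    ext i j; fin_cases i <;> fin_cases j <;> simp [ha, hb, h11, h10]
  have hdet : normSq a - normSq b = 1 := by
    have := hd
    rw [hform, det_of_form] at this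
    exact_mod_cast this
  refine ⟨a.re + b.re, a.im - b.im, -a.im - b.im, a.re - b.re, ?_, ?_⟩
  · have := hdet
    simp only [normSq_apply] at this
    linear_combination this
  · rw [cayleyConj_real, hform]
    ext i j
    fin_cases i <;> fin_cases j <;>
      simp [cayleyA, cayleyB, Complex.ext_iff, map_ofNat, Complex.div_ofNat_re,
        Complex.div_ofNat_im] <;>
      ring

/-- `SO(2) → K_W ∩ SU(1,1)`: `C · rotation θ · C⁻¹ = !![exp(-θ I), 0; 0, exp(θ I)]`. -/
theorem cayleyConj_rotation (θ : ℝ) :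
    cayleyConj (rotation θ) = !![exp (-(θ : ℂ) * I), 0; 0, exp ((θ : ℂ) * I)] := by
  rw [show rotation θ = !![((Real.cos θ : ℝ) : ℂ), ((-Real.sin θ : ℝ) : ℂ);
      ((Real.sin θ : ℝ) : ℂ), ((Real.cos θ : ℝ) : ℂ)] by simp [rotation], cayleyConj_real]
  have h1 : exp (-(θ : ℂ) * I) = (Real.cos θ : ℂ) - (Real.sin θ : ℂ) * I := by
    rw [show -(θ : ℂ) * I = ((-θ : ℝ) : ℂ) * I by push_cast; ring, Complex.exp_mul_I,
      ← Complex.ofReal_cos, ← Complex.ofReal_sin, Real.cos_neg, Real.sin_neg]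
    push_cast; ring
  have h2 : exp ((θ : ℂ) * I) = (Real.cos θ : ℂ) + (Real.sin θ : ℂ) * I := by
    rw [Complex.exp_mul_I, ← Complex.ofReal_cos, ← Complex.ofReal_sin]
  rw [h1, h2]
  ext i j
  fin_cases i <;> fin_cases j <;>
    simp [cayleyA, cayleyB, Complex.ext_iff, map_ofNat, Complex.div_ofNat_re,
      Complex.div_ofNat_im] <;>
    ring

/-- The opposite orientation of `SO(2)`: `C · rotation (-θ) · C⁻¹ = !![exp(θ I), 0; 0, exp(-θ I)]`. -/
theorem cayleyConj_rotation_neg (θ : ℝ) :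
    cayleyConj (rotation (-θ)) = !![exp ((θ : ℂ) * I), 0; 0, exp (-(θ : ℂ) * I)] := by
  rw [cayleyConj_rotation]; push_cast; rw [neg_neg]

/-- The split Cartan of `SL(2,ℝ)` goes to `hyperbolicC t = !![cosh t, sinh t; sinh t, cosh t]`. -/
theorem cayleyConj_cartanReal (t : ℝ) :
    cayleyConj (cartanReal t) = T5UnitaryBound.hyperbolicC t := by
  rw [show cartanReal t = !![((Real.exp t : ℝ) : ℂ), ((0 : ℝ) : ℂ);
      ((0 : ℝ) : ℂ), ((Real.exp (-t) : ℝ) : ℂ)] by simp [cartanReal], cayleyConj_real]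
  unfold T5UnitaryBound.hyperbolicC
  have hc : (Real.cosh t : ℂ) = (((Real.exp t + Real.exp (-t)) / 2 : ℝ) : ℂ) := by
    rw [Real.cosh_eq]
  have hs : (Real.sinh t : ℂ) = (((Real.exp t - Real.exp (-t)) / 2 : ℝ) : ℂ) := by
    rw [Real.sinh_eq]
  rw [hc, hs]
  ext i j
  fin_cases i <;> fin_cases j <;>
    simp [cayleyA, cayleyB, map_ofNat, -Complex.ofReal_exp]

/-- `rotation` is a homomorphism `ℝ → SO(2)`. -/
theorem rotation_add (θ₁ θ₂ : ℝ) : rotation (θ₁ + θ₂) = rotation θ₁ * rotation θ₂ := by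
  unfold rotation
  ext i j
  fin_cases i <;> fin_cases j <;>
    simp [Matrix.mul_apply, Fin.sum_univ_two, Real.cos_add, Real.sin_add] <;> ring

/-- `det (rotation θ) = 1`. -/
theorem det_rotation (θ : ℝ) : (rotation θ).det = 1 := by
  unfold rotation
  rw [Matrix.det_fin_two_of]
  have := Real.sin_sq_add_cos_sq θ
  have h : (Real.sin θ : ℂ) ^ 2 + (Real.cos θ : ℂ) ^ 2 = 1 := by exact_mod_cast this
  linear_combination h

/-- `det (cartanReal t) = 1`. -/
theorem det_cartanReal (t : ℝ) : (cartanReal t).det = 1 := by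
  unfold cartanReal
  rw [Matrix.det_fin_two_of]
  have : Real.exp t * Real.exp (-t) = 1 := by rw [← Real.exp_add]; simp
  have h : (Real.exp t : ℂ) * (Real.exp (-t) : ℂ) = 1 := by exact_mod_cast this
  linear_combination h

/-- The torus character `(m, n)` — `!![z₁, 0; 0, z₂] ↦ z₁^m z₂^n` — on the image of `rotation θ`
is `exp ((n − m) θ I)`: the `SO(2)`-weight of the `K_W`-character `(m, n)` is `n − m` in the
orientation of `rotation`. -/
theorem torus_character_rotation (m n : ℤ) (θ : ℝ) :
    exp (-(θ : ℂ) * I) ^ m * exp ((θ : ℂ) * I) ^ n = exp (((n - m : ℤ) : ℂ) * ((θ : ℂ) * I)) := by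
  rw [← Complex.exp_int_mul, ← Complex.exp_int_mul, ← Complex.exp_add]
  congr 1; push_cast; ring

/-- The same in the opposite orientation (`rotation (-θ)`): the weight is `m − n`. -/
theorem torus_character_rotation_neg (m n : ℤ) (θ : ℝ) :
    exp ((θ : ℂ) * I) ^ m * exp (-(θ : ℂ) * I) ^ n = exp (((m - n : ℤ) : ℂ) * ((θ : ℂ) * I)) := by
  rw [← Complex.exp_int_mul, ← Complex.exp_int_mul, ← Complex.exp_add]
  congr 1; push_cast; ring

/-- The `K_W`-type `((m′+3)/2 + k, (m′−3)/2 − k)` of (N4.3.P2-bis) (`m′` odd) restricts to the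
`SO(2)`-weight `3 + 2k` of (N4.3.P2′): first coordinate minus second. -/
theorem ktype_weight {m' : ℤ} (hm : Odd m') (k : ℤ) :
    ((m' + 3) / 2 + k) - ((m' - 3) / 2 - k) = 3 + 2 * k := by
  obtain ⟨j, rfl⟩ := hm
  omega

/-- Every unit complex number is `exp (θ I)` for a real `θ` (its argument). -/
theorem exists_exp_of_norm_eq_one {u : ℂ} (hu : ‖u‖ = 1) : ∃ θ : ℝ, u = exp ((θ : ℂ) * I) := by
  refine ⟨Complex.arg u, ?_⟩
  have := Complex.norm_mul_exp_arg_mul_I u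
  rw [hu, Complex.ofReal_one, one_mul] at this
  exact this.symm

/-- `SL(2,ℝ) = SO(2) · A⁺ · SO(2)`: every real `!![p, q; r, s]` with `ps − qr = 1` is
`rotation θ₁ * cartanReal t * rotation θ₂` with `t ≥ 0` — transported from
`T5CartanSU11.exists_cartan_det_one` through the Cayley transform. -/
theorem exists_cartan_real {p q r s : ℝ} (h : p * s - q * r = 1) :
    ∃ θ₁ t θ₂ : ℝ, 0 ≤ t ∧
      !![(p : ℂ), (q : ℂ); (r : ℂ), (s : ℂ)] = rotation θ₁ * cartanReal t * rotation θ₂ := by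
  have hg := memU11_cayleyConj_real h
  have hd : (cayleyConj !![(p : ℂ), (q : ℂ); (r : ℂ), (s : ℂ)]).det = 1 := by
    rw [det_cayleyConj_real, h]; simp
  obtain ⟨α, β, t, hα, hβ, ht, hcart⟩ := T5CartanSU11.exists_cartan_det_one hg hd
  obtain ⟨θ₁, rfl⟩ := exists_exp_of_norm_eq_one hα
  obtain ⟨θ₂, rfl⟩ := exists_exp_of_norm_eq_one hβ
  refine ⟨-θ₁, t, -θ₂, ht, ?_⟩
  apply cayleyConj_injective
  rw [hcart, cayleyConj_mul, cayleyConj_mul, cayleyConj_rotation_neg, cayleyConj_rotation_neg,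
    cayleyConj_cartanReal]
  have e1 : ∀ φ : ℝ, conj (exp ((φ : ℂ) * I)) = exp (-(φ : ℂ) * I) := by
    intro φ
    rw [← Complex.exp_conj]
    congr 1
    simp only [map_mul, Complex.conj_ofReal, Complex.conj_I]
    ring
  rw [e1, e1]

end Summit.Ventures.HodgeRepro2.T5CayleySU11

end
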